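import Summits.NavierStokesRegularity.NavierStokesRegularity.Theorems.EulerZoomLiouvillePowerGaugeEulerLiouvilleEnergySaturationShellReal
import Summits.NavierStokesRegularity.NavierStokesRegularity.Theorems.EulerZoomLiouvillePowerGaugeEulerLiouvillePressureSplitSlice

/-!
# Energy saturation on rung C1 of the crux `EulerZoomLiouville.PowerGaugeEulerLiouville`, V:
# the pressure–velocity mass on balls through the tail supremum (the lead's pressure splitting)
# (crux = stmt-NavierStokesRegularity-19832, route №10 `EulerZoomLiouville`, line `birth`)

Seat `ns-ezl-19832-w2` (stub-worker under the crux lead `ns-ezl-19832-p1`), cell ns-regularity-ideate.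

The pressure half of the shell flux.  A profile `(V, P)` of an exactly self-similar member satisfies the
weak Poisson equation `∫ P Δθ = −∫ D²θ(V, V)` (typeII-p1's `profile_pressure_poisson`), so on every ball
the lead's LOCAL PRESSURE SPLITTING `exists_setLIntegral_pressure_velocity_ball_le` (`P = Π[V·1_B] + h`,
`h` weakly harmonic in `B`, Calderón–Zygmund + interior harmonic bound) applies:
`∫_{B_{R/2}} |P||V| ≤ c_L [∫_{B_R}|V|³ + R⁻³ (∫_{B_{R/2}}|V|)(∫_{B_R}|P| + R (∫_{B_R}|V|³)^{2/3})]`.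
Feeding it the ball bounds of file IV (`…EnergySaturationShellReal`) in terms of the tail supremum `S`
of the normalised energy (`∫σ(R⁻¹y)|V|² ≤ R^{1−2ρ}S`, `0 ≤ S ≤ 3c`, `R ≥ 1`) gives

* `exists_lintegral_halfBall_pressure_velocity_le_of_sup` —
  `∫_{B_{R/2}} |P||V| ≤ K₇ · S^{1/2} · R^{(6−9ρ)/4}`, the SAME rate as the cubic term: every pressure
  piece is at least as good as `|V|³` (`R^{(4−7ρ)/3}, R^{(6−15ρ)/6} ≤ R^{(6−9ρ)/4}` for `R ≥ 1`), so the
  energy-saturation bootstrap has NO threshold in `ρ` (the crude Hölder bound `‖P‖_{3/2}‖V‖₃` would stop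
  at `ρ > 7/19`);
* `lintegral_halfBall_pressure_velocity_lt_top`, `locallyIntegrable_pressure_velocity`,
  `locallyIntegrable_norm_cube` — finiteness / local integrability of `|P||V|` and `|V|³` from the class
  data (the case `S = 3c`), the integrability inputs of the flux bound `abs_flux_le` (file I).

WHAT THIS IS NOT: not NS regularity, not the crux, not rung C1 — estimates serving the energy-saturation
stratum (Bronzi–Shvydkoy 2015 Thm 1.1 in the weak class); `--supports` stmt-19832. [folklore]
-/

noncomputable section

set_option linter.dupNamespace false

open MeasureTheory Set Filter Topology Metric Function TopologicalSpace
open scoped ENNReal NNReal RealInnerProductSpace ContDiff Laplacian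

namespace Summit.NavierStokesRegularity.NavierStokesRegularity.Theorems.PowerGaugeEulerLiouville

open Literature.Analysis Literature.Analysis.FunctionSpaces Literature.Analysis.FluidPDE

namespace EnergySaturation

variable {ρ : ℝ} {σ : EuclideanSpace ℝ (Fin 3) → ℝ}
  {V : EuclideanSpace ℝ (Fin 3) → EuclideanSpace ℝ (Fin 3)} {P : EuclideanSpace ℝ (Fin 3) → ℝ}
  {G : EuclideanSpace ℝ (Fin 3) → EuclideanSpace ℝ (Fin 3) →L[ℝ] EuclideanSpace ℝ (Fin 3)}

/-- `(R³)⁻¹ = R^{−3}` for `R > 0`. [folklore] -/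
theorem inv_pow_three_eq_rpow {R : ℝ} (hR : 0 < R) : (R ^ 3)⁻¹ = R ^ (-3 : ℝ) := by
  rw [Real.rpow_neg hR.le, show (3 : ℝ) = ((3 : ℕ) : ℝ) by norm_num, Real.rpow_natCast]

/-- **The pressure–velocity mass on a half ball through the tail supremum.**  Under the class data
(weak gradient, `A`-growth, `E`- and `D`-weights, `0 < ρ < 1`), the weak Poisson equation
`∫ P Δθ = −∫ D²θ(V,V)` and a cut-off `σ` as in `exists_radialCutoff` with `‖Dσ‖ ≤ M`, there is
`K₇ ≥ 0` (depending on `ρ, c, M` only) such that for all `0 ≤ S ≤ 3c`, `R ≥ 1` with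
`∫σ(R⁻¹y)|V|² ≤ R^{1−2ρ} S`:  `∫_{B_{R/2}} |P||V| ≤ K₇ S^{1/2} R^{(6−9ρ)/4}`.  (The lead's local pressure
splitting `exists_setLIntegral_pressure_velocity_ball_le` fed with file IV's ball bounds.) [folklore] -/
theorem exists_lintegral_halfBall_pressure_velocity_le_of_sup (hρ : 0 < ρ) (hρ1 : ρ < 1)
    (hσ : IsTestFunctionOn (⊤ : Opens (EuclideanSpace ℝ (Fin 3))) σ) (h0 : ∀ z, 0 ≤ σ z)
    (h1 : ∀ z, σ z ≤ 1) (hone : ∀ z, ‖z‖ ≤ 1 → σ z = 1) (hzero : ∀ z, 2 ≤ ‖z‖ → σ z = 0)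
    {M : ℝ} (hM : ∀ z, ‖fderiv ℝ σ z‖ ≤ M)
    (hVm : AEStronglyMeasurable V volume) (hPm : AEStronglyMeasurable P volume)
    (hGm : AEStronglyMeasurable G volume)
    (hVG : HasWeakFDerivOn (⊤ : Opens (EuclideanSpace ℝ (Fin 3))) volume V G) {c : ℝ≥0}
    (hA : ∀ L : ℝ, 0 < L → ∫⁻ y in ball (0 : EuclideanSpace ℝ (Fin 3)) L, ‖V y‖ₑ ^ 2 ≤
      (c : ℝ≥0∞) * ENNReal.ofReal (L ^ (1 - 2 * ρ)))
    (hE : ∫⁻ y, ENNReal.ofReal (frobeniusNormSq (G y)) * ENNReal.ofReal (‖y‖ ^ (ρ - 1)) ≤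
      ENNReal.ofReal ((1 - ρ) / (2 + ρ)) * (c : ℝ≥0∞))
    (hD : ∫⁻ y, ‖P y‖ₑ ^ (3 / 2 : ℝ) * ENNReal.ofReal (‖y‖ ^ (2 * ρ - 2)) ≤
      ENNReal.ofReal ((2 - 2 * ρ) / (2 + ρ)) * (c : ℝ≥0∞))
    (hPoisson : ∀ θ : EuclideanSpace ℝ (Fin 3) → ℝ, ContDiff ℝ (⊤ : ℕ∞) θ → HasCompactSupport θ →
      ∫ y, P y * (Δ θ) y = -∫ y, fderiv ℝ (fderiv ℝ θ) y (V y) (V y)) :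
    ∃ K₇ : ℝ, 0 ≤ K₇ ∧ ∀ S : ℝ, 0 ≤ S → S ≤ 3 * c → ∀ R : ℝ, 1 ≤ R →
      (∫ y, σ (R⁻¹ • y) * ‖V y‖ ^ 2 ≤ R ^ (1 - 2 * ρ) * S) →
        ∫⁻ y in ball (0 : EuclideanSpace ℝ (Fin 3)) (R / 2), ‖P y‖ₑ * ‖V y‖ₑ ≤
          ENNReal.ofReal (K₇ * S ^ (1 / 2 : ℝ) * R ^ ((6 - 9 * ρ) / 4)) := by
  obtain ⟨cL, hcL⟩ := exists_setLIntegral_pressure_velocity_ball_le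
  have hV2 : LocallyIntegrable (fun y => ‖V y‖ ^ 2) volume := locallyIntegrable_norm_sq_of_growth hVm hA
  have hc0 : (0 : ℝ) ≤ c := c.2
  have h1ρ : 0 ≤ (1 - ρ) / (2 + ρ) := by apply div_nonneg <;> linarith
  have h2ρ : 0 ≤ (2 - 2 * ρ) / (2 + ρ) := by apply div_nonneg <;> linarith
  -- the constants of file IV
  set K₂ : ℝ := ((SNormLESNormFDerivOfEqConst (EuclideanSpace ℝ (Fin 3))
      (volume : Measure (EuclideanSpace ℝ (Fin 3))) 2 : ℝ) ^ (3 / 2 : ℝ) *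
    (2 * (3 : ℝ) ^ (1 - ρ) * ((1 - ρ) / (2 + ρ) * c) + 6 * M ^ 2 * (3 : ℝ) ^ (1 - 2 * ρ) * c) ^ (3 / 4 : ℝ) *
    (3 * c) ^ (1 / 4 : ℝ)) with hK₂
  set K₅ : ℝ := ((volume (ball (0 : EuclideanSpace ℝ (Fin 3)) 1)).toReal / 8) ^ (1 / 2 : ℝ) with hK₅
  set K₆ : ℝ := (volume (ball (0 : EuclideanSpace ℝ (Fin 3)) 1)).toReal ^ (1 / 3 : ℝ) *
    ((2 - 2 * ρ) / (2 + ρ) * c) ^ (2 / 3 : ℝ) with hK₆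
  have hK₂0 : 0 ≤ K₂ := by positivity
  have hK₅0 : 0 ≤ K₅ := by positivity
  have hK₆0 : 0 ≤ K₆ := by positivity
  refine ⟨cL * (K₂ + K₅ * K₆ + K₅ * K₂ ^ (2 / 3 : ℝ) * (3 * c) ^ (1 / 3 : ℝ)), by positivity, ?_⟩
  intro S hS hS3 R hR hsup
  have hR0 : 0 < R := lt_of_lt_of_le one_pos hR
  -- file IV's ball bounds
  have hC3 := lintegral_ball_cube_le_of_sup hρ hρ1 hσ h0 h1 hone hzero hM hVm hGm hVG hA hE hS hS3 hR hsup
  have hV1 := lintegral_halfBall_norm_le_of_sup (ρ := ρ) hσ.contDiff.continuous hσ.hasCompactSupport h0 hone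
    hVm hV2 hS hR0 hsup
  have hP1 := lintegral_ball_pressure_one_le hρ hρ1 hPm hD hR0
  rw [← hK₂] at hC3
  rw [← hK₅] at hV1
  rw [← hK₆] at hP1
  -- exponent bookkeeping (all `R`-powers are dominated by `R^E`, `E = (6 − 9ρ)/4`, for `R ≥ 1`)
  set E : ℝ := (6 - 9 * ρ) / 4 with hEdef
  have hexp2 : (4 - 7 * ρ) / 3 ≤ E := by rw [hEdef]; linarith
  have hexp3 : -ρ + E * (2 / 3) ≤ E := by rw [hEdef]; linarith
  have hS12 : 0 ≤ S ^ (1 / 2 : ℝ) := Real.rpow_nonneg hS _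
  have hRE : 0 ≤ R ^ E := Real.rpow_nonneg hR0.le _
  set a : ℝ := K₂ * S ^ (1 / 2 : ℝ) * R ^ E with ha
  set b : ℝ := K₅ * S ^ (1 / 2 : ℝ) * R ^ (2 - ρ) with hb
  set p₁ : ℝ := K₆ * R ^ ((7 - 4 * ρ) / 3) with hp₁
  have ha0 : 0 ≤ a := by positivity
  have hb0 : 0 ≤ b := by positivity
  have hp0 : 0 ≤ p₁ := by positivity
  clear_value a b p₁
  -- finiteness inputs of the lead's lemma
  have hD32 : ∫⁻ y in ball (0 : EuclideanSpace ℝ (Fin 3)) R, ‖P y‖ₑ ^ (3 / 2 : ℝ) < ⊤ :=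
    lt_of_le_of_lt (lintegral_ball_pressure_le_of_weight hρ1 hD hR0)
      (ENNReal.mul_lt_top ENNReal.ofReal_lt_top (ENNReal.mul_lt_top ENNReal.ofReal_lt_top ENNReal.coe_lt_top))
  have hC3fin : ∫⁻ y in ball (0 : EuclideanSpace ℝ (Fin 3)) R, ‖V y‖ₑ ^ (3 : ℕ) < ⊤ :=
    lt_of_le_of_lt hC3 ENNReal.ofReal_lt_top
  -- the lead's local pressure splitting on `B_R`
  have hlead := hcL 0 R P V hR0 hPm.restrict hVm.restrict hD32 hC3fin
    (fun ψ hψ hψc _ => hPoisson ψ hψ hψc)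
  refine hlead.trans ?_
  -- substitute the ball bounds
  have hstep : (cL : ℝ≥0∞) * ((∫⁻ y in ball (0 : EuclideanSpace ℝ (Fin 3)) R, ‖V y‖ₑ ^ (3 : ℕ)) +
      ENNReal.ofReal ((R ^ 3)⁻¹) * (∫⁻ y in ball (0 : EuclideanSpace ℝ (Fin 3)) (R / 2), ‖V y‖ₑ) *
        ((∫⁻ y in ball (0 : EuclideanSpace ℝ (Fin 3)) R, ‖P y‖ₑ) +
          ENNReal.ofReal R * (∫⁻ y in ball (0 : EuclideanSpace ℝ (Fin 3)) R, ‖V y‖ₑ ^ (3 : ℕ)) ^ (2 / 3 : ℝ))) ≤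
      (cL : ℝ≥0∞) * (ENNReal.ofReal a + ENNReal.ofReal ((R ^ 3)⁻¹) * ENNReal.ofReal b *
        (ENNReal.ofReal p₁ + ENNReal.ofReal R * (ENNReal.ofReal a) ^ (2 / 3 : ℝ))) := by
    gcongr
  refine hstep.trans ?_
  -- fold into one `ofReal`
  have hr3 : (0 : ℝ) ≤ (R ^ 3)⁻¹ := by positivity
  have efold : ENNReal.ofReal (cL * (a + (R ^ 3)⁻¹ * b * (p₁ + R * a ^ (2 / 3 : ℝ)))) =
      (cL : ℝ≥0∞) * (ENNReal.ofReal a + ENNReal.ofReal ((R ^ 3)⁻¹) * ENNReal.ofReal b *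
        (ENNReal.ofReal p₁ + ENNReal.ofReal R * (ENNReal.ofReal a) ^ (2 / 3 : ℝ))) := by
    have h1 : ENNReal.ofReal (R * a ^ (2 / 3 : ℝ)) = ENNReal.ofReal R * (ENNReal.ofReal a) ^ (2 / 3 : ℝ) := by
      rw [ENNReal.ofReal_mul hR0.le, ENNReal.ofReal_rpow_of_nonneg ha0 (by norm_num)]
    have h2 : ENNReal.ofReal (p₁ + R * a ^ (2 / 3 : ℝ)) =
        ENNReal.ofReal p₁ + ENNReal.ofReal R * (ENNReal.ofReal a) ^ (2 / 3 : ℝ) := by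
      rw [ENNReal.ofReal_add hp0 (by positivity), h1]
    have h3 : ENNReal.ofReal ((R ^ 3)⁻¹ * b * (p₁ + R * a ^ (2 / 3 : ℝ))) =
        ENNReal.ofReal ((R ^ 3)⁻¹) * ENNReal.ofReal b *
          (ENNReal.ofReal p₁ + ENNReal.ofReal R * (ENNReal.ofReal a) ^ (2 / 3 : ℝ)) := by
      rw [ENNReal.ofReal_mul (mul_nonneg hr3 hb0), ENNReal.ofReal_mul hr3, h2]
    have h4 : ENNReal.ofReal (a + (R ^ 3)⁻¹ * b * (p₁ + R * a ^ (2 / 3 : ℝ))) =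
        ENNReal.ofReal a + ENNReal.ofReal ((R ^ 3)⁻¹) * ENNReal.ofReal b *
          (ENNReal.ofReal p₁ + ENNReal.ofReal R * (ENNReal.ofReal a) ^ (2 / 3 : ℝ)) := by
      rw [ENNReal.ofReal_add ha0 (by positivity), h3]
    rw [ENNReal.ofReal_mul (NNReal.coe_nonneg _), ENNReal.ofReal_coe_nnreal, h4]
  rw [← efold]
  refine ENNReal.ofReal_le_ofReal ?_
  -- ### the real inequality: every term `≤ const · S^{1/2} R^E`
  -- term 2: `R⁻³ b p₁ = K₅ K₆ S^{1/2} R^{(4−7ρ)/3} ≤ K₅ K₆ S^{1/2} R^E`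
  have ht2 : (R ^ 3)⁻¹ * b * p₁ ≤ K₅ * K₆ * S ^ (1 / 2 : ℝ) * R ^ E := by
    have e : (R ^ 3)⁻¹ * b * p₁ = K₅ * K₆ * S ^ (1 / 2 : ℝ) * R ^ ((4 - 7 * ρ) / 3) := by
      rw [hb, hp₁, inv_pow_three_eq_rpow hR0]
      have : R ^ (-3 : ℝ) * R ^ (2 - ρ) * R ^ ((7 - 4 * ρ) / 3) = R ^ ((4 - 7 * ρ) / 3) := by
        rw [← Real.rpow_add hR0, ← Real.rpow_add hR0]; ring_nf
      calc R ^ (-3 : ℝ) * (K₅ * S ^ (1 / 2 : ℝ) * R ^ (2 - ρ)) * (K₆ * R ^ ((7 - 4 * ρ) / 3))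
          = K₅ * K₆ * S ^ (1 / 2 : ℝ) * (R ^ (-3 : ℝ) * R ^ (2 - ρ) * R ^ ((7 - 4 * ρ) / 3)) := by ring
        _ = _ := by rw [this]
    rw [e]
    exact mul_le_mul_of_nonneg_left (Real.rpow_le_rpow_of_exponent_le hR hexp2) (by positivity)
  -- term 3: `R⁻³ b R a^{2/3} = K₅ K₂^{2/3} S^{5/6} R^{−ρ+2E/3} ≤ K₅ K₂^{2/3} (3c)^{1/3} S^{1/2} R^E`
  have ht3 : (R ^ 3)⁻¹ * b * (R * a ^ (2 / 3 : ℝ)) ≤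
      K₅ * K₂ ^ (2 / 3 : ℝ) * (3 * c) ^ (1 / 3 : ℝ) * S ^ (1 / 2 : ℝ) * R ^ E := by
    have ea : a ^ (2 / 3 : ℝ) = K₂ ^ (2 / 3 : ℝ) * S ^ (1 / 3 : ℝ) * R ^ (E * (2 / 3)) := by
      rw [ha, Real.mul_rpow (by positivity) hRE, Real.mul_rpow hK₂0 hS12, ← Real.rpow_mul hS,
        ← Real.rpow_mul hR0.le]
      norm_num
    have e : (R ^ 3)⁻¹ * b * (R * a ^ (2 / 3 : ℝ)) =
        K₅ * K₂ ^ (2 / 3 : ℝ) * (S ^ (1 / 2 : ℝ) * S ^ (1 / 3 : ℝ)) * R ^ (-ρ + E * (2 / 3)) := by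
      rw [hb, ea, inv_pow_three_eq_rpow hR0]
      have : R ^ (-3 : ℝ) * R ^ (2 - ρ) * R ^ (1 : ℝ) * R ^ (E * (2 / 3)) = R ^ (-ρ + E * (2 / 3)) := by
        rw [← Real.rpow_add hR0, ← Real.rpow_add hR0, ← Real.rpow_add hR0]; ring_nf
      calc R ^ (-3 : ℝ) * (K₅ * S ^ (1 / 2 : ℝ) * R ^ (2 - ρ)) *
            (R * (K₂ ^ (2 / 3 : ℝ) * S ^ (1 / 3 : ℝ) * R ^ (E * (2 / 3))))
          = K₅ * K₂ ^ (2 / 3 : ℝ) * (S ^ (1 / 2 : ℝ) * S ^ (1 / 3 : ℝ)) *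
              (R ^ (-3 : ℝ) * R ^ (2 - ρ) * R ^ (1 : ℝ) * R ^ (E * (2 / 3))) := by
            rw [Real.rpow_one]; ring
        _ = _ := by rw [this]
    rw [e]
    -- `S^{1/2} S^{1/3} = S^{5/6} ≤ (3c)^{1/3} S^{1/2}` and `R^{−ρ+2E/3} ≤ R^E`
    have hS56 : S ^ (1 / 2 : ℝ) * S ^ (1 / 3 : ℝ) ≤ (3 * c) ^ (1 / 3 : ℝ) * S ^ (1 / 2 : ℝ) := by
      rw [mul_comm]
      exact mul_le_mul_of_nonneg_right (Real.rpow_le_rpow hS hS3 (by norm_num)) hS12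
    have hRle : R ^ (-ρ + E * (2 / 3)) ≤ R ^ E :=
      Real.rpow_le_rpow_of_exponent_le hR hexp3
    calc K₅ * K₂ ^ (2 / 3 : ℝ) * (S ^ (1 / 2 : ℝ) * S ^ (1 / 3 : ℝ)) * R ^ (-ρ + E * (2 / 3))
        ≤ K₅ * K₂ ^ (2 / 3 : ℝ) * ((3 * c) ^ (1 / 3 : ℝ) * S ^ (1 / 2 : ℝ)) * R ^ E := by
          gcongr
      _ = _ := by ring
  -- assemble
  have hsum : a + (R ^ 3)⁻¹ * b * (p₁ + R * a ^ (2 / 3 : ℝ)) ≤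
      (K₂ + K₅ * K₆ + K₅ * K₂ ^ (2 / 3 : ℝ) * (3 * c) ^ (1 / 3 : ℝ)) * S ^ (1 / 2 : ℝ) * R ^ E := by
    have hsplit : a + (R ^ 3)⁻¹ * b * (p₁ + R * a ^ (2 / 3 : ℝ)) =
        a + ((R ^ 3)⁻¹ * b * p₁ + (R ^ 3)⁻¹ * b * (R * a ^ (2 / 3 : ℝ))) := by ring
    calc a + (R ^ 3)⁻¹ * b * (p₁ + R * a ^ (2 / 3 : ℝ))
        = a + ((R ^ 3)⁻¹ * b * p₁ + (R ^ 3)⁻¹ * b * (R * a ^ (2 / 3 : ℝ))) := hsplit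
      _ ≤ a + (K₅ * K₆ * S ^ (1 / 2 : ℝ) * R ^ E +
            K₅ * K₂ ^ (2 / 3 : ℝ) * (3 * c) ^ (1 / 3 : ℝ) * S ^ (1 / 2 : ℝ) * R ^ E) :=
          add_le_add le_rfl (add_le_add ht2 ht3)
      _ = _ := by rw [ha]; ring
  calc (cL : ℝ) * (a + (R ^ 3)⁻¹ * b * (p₁ + R * a ^ (2 / 3 : ℝ)))
      ≤ cL * ((K₂ + K₅ * K₆ + K₅ * K₂ ^ (2 / 3 : ℝ) * (3 * c) ^ (1 / 3 : ℝ)) * S ^ (1 / 2 : ℝ) * R ^ E) :=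
        mul_le_mul_of_nonneg_left hsum (NNReal.coe_nonneg _)
    _ = cL * (K₂ + K₅ * K₆ + K₅ * K₂ ^ (2 / 3 : ℝ) * (3 * c) ^ (1 / 3 : ℝ)) * S ^ (1 / 2 : ℝ) * R ^ E := by
        ring


/-! ## The case `S = 3c`: finiteness and local integrability from the class data -/

/-- The tail supremum `S = 3c` is always admissible: `∫σ(R⁻¹y)|V|² ≤ R^{1−2ρ}·(3c)` for every `R > 0`
(`normEnergy_le_of_growth` and `3^{1−2ρ} ≤ 3`). [folklore] -/
theorem cutoffEnergy_le_three (hρ : 0 < ρ) (h0 : ∀ z, 0 ≤ σ z) (h1 : ∀ z, σ z ≤ 1)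
    (hzero : ∀ z, 2 ≤ ‖z‖ → σ z = 0) (hVm : AEStronglyMeasurable V volume) {c : ℝ≥0}
    (hA : ∀ L : ℝ, 0 < L → ∫⁻ y in ball (0 : EuclideanSpace ℝ (Fin 3)) L, ‖V y‖ₑ ^ 2 ≤
      (c : ℝ≥0∞) * ENNReal.ofReal (L ^ (1 - 2 * ρ))) {R : ℝ} (hR : 0 < R) :
    ∫ y, σ (R⁻¹ • y) * ‖V y‖ ^ 2 ≤ R ^ (1 - 2 * ρ) * (3 * c) := by
  have h := normEnergy_le_of_growth (ρ := ρ) h0 h1 hzero hVm hA hR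
  have hc0 : (0 : ℝ) ≤ c := c.2
  have h3 : (3 : ℝ) ^ (1 - 2 * ρ) ≤ 3 := by
    conv_rhs => rw [← Real.rpow_one 3]
    exact Real.rpow_le_rpow_of_exponent_le (by norm_num) (by linarith)
  have hRR : R ^ (1 - 2 * ρ) * R ^ (2 * ρ - 1) = 1 := by
    rw [← Real.rpow_add hR]; norm_num
  calc ∫ y, σ (R⁻¹ • y) * ‖V y‖ ^ 2
      = R ^ (1 - 2 * ρ) * (R ^ (2 * ρ - 1) * ∫ y, σ (R⁻¹ • y) * ‖V y‖ ^ 2) := by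
        rw [← mul_assoc, hRR, one_mul]
    _ ≤ R ^ (1 - 2 * ρ) * ((3 : ℝ) ^ (1 - 2 * ρ) * c) :=
        mul_le_mul_of_nonneg_left h (Real.rpow_nonneg hR.le _)
    _ ≤ R ^ (1 - 2 * ρ) * (3 * c) := by gcongr

/-- **`|V|³ ∈ L¹_loc`** from the class data (the cubic ball bound at `S = 3c`). [folklore] -/
theorem locallyIntegrable_norm_cube (hρ : 0 < ρ) (hρ1 : ρ < 1)
    (hσ : IsTestFunctionOn (⊤ : Opens (EuclideanSpace ℝ (Fin 3))) σ) (h0 : ∀ z, 0 ≤ σ z)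
    (h1 : ∀ z, σ z ≤ 1) (hone : ∀ z, ‖z‖ ≤ 1 → σ z = 1) (hzero : ∀ z, 2 ≤ ‖z‖ → σ z = 0)
    {M : ℝ} (hM : ∀ z, ‖fderiv ℝ σ z‖ ≤ M)
    (hVm : AEStronglyMeasurable V volume) (hGm : AEStronglyMeasurable G volume)
    (hVG : HasWeakFDerivOn (⊤ : Opens (EuclideanSpace ℝ (Fin 3))) volume V G) {c : ℝ≥0}
    (hA : ∀ L : ℝ, 0 < L → ∫⁻ y in ball (0 : EuclideanSpace ℝ (Fin 3)) L, ‖V y‖ₑ ^ 2 ≤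
      (c : ℝ≥0∞) * ENNReal.ofReal (L ^ (1 - 2 * ρ)))
    (hE : ∫⁻ y, ENNReal.ofReal (frobeniusNormSq (G y)) * ENNReal.ofReal (‖y‖ ^ (ρ - 1)) ≤
      ENNReal.ofReal ((1 - ρ) / (2 + ρ)) * (c : ℝ≥0∞)) :
    (∀ R : ℝ, 1 ≤ R → IntegrableOn (fun y => ‖V y‖ ^ 3) (ball (0 : EuclideanSpace ℝ (Fin 3)) R) volume) ∧
      LocallyIntegrable (fun y => ‖V y‖ ^ 3) volume := by
  have hc0 : (0 : ℝ) ≤ c := c.2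
  have hball : ∀ R : ℝ, 1 ≤ R → IntegrableOn (fun y => ‖V y‖ ^ 3) (ball (0 : EuclideanSpace ℝ (Fin 3)) R) volume := by
    intro R hR
    have hR0 : 0 < R := lt_of_lt_of_le one_pos hR
    have hfin := lt_of_le_of_lt
      (lintegral_ball_cube_le_of_sup hρ hρ1 hσ h0 h1 hone hzero hM hVm hGm hVG hA hE
        (by positivity : (0 : ℝ) ≤ 3 * c) le_rfl hR (cutoffEnergy_le_three hρ h0 h1 hzero hVm hA hR0))
      ENNReal.ofReal_lt_top
    refine ⟨(hVm.norm.pow 3).restrict, ?_⟩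
    rw [hasFiniteIntegral_iff_enorm]
    refine lt_of_le_of_lt (le_of_eq (lintegral_congr fun y => ?_)) hfin
    rw [Real.enorm_eq_ofReal (by positivity), ENNReal.ofReal_pow (norm_nonneg _), ofReal_norm]
  refine ⟨hball, fun x => ?_⟩
  refine ⟨ball 0 (‖x‖ + 1), isOpen_ball.mem_nhds (by rw [mem_ball, dist_zero_right]; linarith), ?_⟩
  exact hball (‖x‖ + 1) (by linarith [norm_nonneg x])

/-- **`|P||V| ∈ L¹_loc`** from the class data and the weak Poisson equation (the pressure–velocity
ball bound at `S = 3c`). [folklore] -/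
theorem locallyIntegrable_pressure_velocity (hρ : 0 < ρ) (hρ1 : ρ < 1)
    (hσ : IsTestFunctionOn (⊤ : Opens (EuclideanSpace ℝ (Fin 3))) σ) (h0 : ∀ z, 0 ≤ σ z)
    (h1 : ∀ z, σ z ≤ 1) (hone : ∀ z, ‖z‖ ≤ 1 → σ z = 1) (hzero : ∀ z, 2 ≤ ‖z‖ → σ z = 0)
    {M : ℝ} (hM : ∀ z, ‖fderiv ℝ σ z‖ ≤ M)
    (hVm : AEStronglyMeasurable V volume) (hPm : AEStronglyMeasurable P volume)
    (hGm : AEStronglyMeasurable G volume)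
    (hVG : HasWeakFDerivOn (⊤ : Opens (EuclideanSpace ℝ (Fin 3))) volume V G) {c : ℝ≥0}
    (hA : ∀ L : ℝ, 0 < L → ∫⁻ y in ball (0 : EuclideanSpace ℝ (Fin 3)) L, ‖V y‖ₑ ^ 2 ≤
      (c : ℝ≥0∞) * ENNReal.ofReal (L ^ (1 - 2 * ρ)))
    (hE : ∫⁻ y, ENNReal.ofReal (frobeniusNormSq (G y)) * ENNReal.ofReal (‖y‖ ^ (ρ - 1)) ≤
      ENNReal.ofReal ((1 - ρ) / (2 + ρ)) * (c : ℝ≥0∞))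
    (hD : ∫⁻ y, ‖P y‖ₑ ^ (3 / 2 : ℝ) * ENNReal.ofReal (‖y‖ ^ (2 * ρ - 2)) ≤
      ENNReal.ofReal ((2 - 2 * ρ) / (2 + ρ)) * (c : ℝ≥0∞))
    (hPoisson : ∀ θ : EuclideanSpace ℝ (Fin 3) → ℝ, ContDiff ℝ (⊤ : ℕ∞) θ → HasCompactSupport θ →
      ∫ y, P y * (Δ θ) y = -∫ y, fderiv ℝ (fderiv ℝ θ) y (V y) (V y)) :
    (∀ R : ℝ, 1 ≤ R →
      IntegrableOn (fun y => |P y| * ‖V y‖) (ball (0 : EuclideanSpace ℝ (Fin 3)) (R / 2)) volume) ∧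
      LocallyIntegrable (fun y => |P y| * ‖V y‖) volume := by
  have hc0 : (0 : ℝ) ≤ c := c.2
  obtain ⟨K₇, hK₇0, hK₇⟩ := exists_lintegral_halfBall_pressure_velocity_le_of_sup hρ hρ1 hσ h0 h1 hone hzero
    hM hVm hPm hGm hVG hA hE hD hPoisson
  have hball : ∀ R : ℝ, 1 ≤ R →
      IntegrableOn (fun y => |P y| * ‖V y‖) (ball (0 : EuclideanSpace ℝ (Fin 3)) (R / 2)) volume := by
    intro R hR
    have hR0 : 0 < R := lt_of_lt_of_le one_pos hR
    have hfin := lt_of_le_of_lt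
      (hK₇ (3 * c) (by positivity) le_rfl R hR (cutoffEnergy_le_three hρ h0 h1 hzero hVm hA hR0))
      ENNReal.ofReal_lt_top
    refine ⟨((hPm.norm).mul hVm.norm).restrict.congr (Eventually.of_forall fun y => by
      simp [Real.norm_eq_abs]), ?_⟩
    rw [hasFiniteIntegral_iff_enorm]
    refine lt_of_le_of_lt (le_of_eq (lintegral_congr fun y => ?_)) hfin
    rw [Real.enorm_eq_ofReal (by positivity), ENNReal.ofReal_mul (abs_nonneg _),
      ← Real.norm_eq_abs, ofReal_norm, ofReal_norm]
  refine ⟨hball, fun x => ?_⟩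
  refine ⟨ball 0 (‖x‖ + 1), isOpen_ball.mem_nhds (by rw [mem_ball, dist_zero_right]; linarith), ?_⟩
  have h := hball (2 * (‖x‖ + 1)) (by linarith [norm_nonneg x])
  rwa [show 2 * (‖x‖ + 1) / 2 = ‖x‖ + 1 by ring] at h

end EnergySaturation

end Summit.NavierStokesRegularity.NavierStokesRegularity.Theorems.PowerGaugeEulerLiouville

end
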